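import Summits.ValiantsHypothesis.ValiantsHypothesis.Theses.ValuativeGCT
import Summits.ValiantsHypothesis.ValiantsHypothesis.Theorems.ValuativeGCTCutBitesDetStabIsUnit
import Summits.ValiantsHypothesis.ValiantsHypothesis.Theorems.ValuativeGCTCutBitesCofactorChainRule
import Summits.ValiantsHypothesis.ValiantsHypothesis.Theorems.ValuativeGCTCutBitesDetStabTranspose
import Summits.ValiantsHypothesis.ValiantsHypothesis.Theorems.ValuativeGCTCutBitesHwExtraction
import Summits.ValiantsHypothesis.ValiantsHypothesis.Theorems.ValuativeGCTCutBitesAdjDetInvariant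
import Summits.ValiantsHypothesis.ValiantsHypothesis.Theorems.ValuativeGCTCutBitesAdjDetIsHomogeneous
import Summits.ValiantsHypothesis.ValiantsHypothesis.Theorems.ValuativeGCTCutBitesAdjDetSparsePoint

/-!
# `ValuativeGCT.CutBites` (crux stmt-ValiantsHypothesis-12626) — THE CUT BITES, via the line `adjugate-pfaffian-kernel`

`CutBites_proof : Theses.ValuativeGCT.CutBites`: for every odd `m ≥ 3` the valuative truncation along the skew
Edmonds-gap space `Λ_m` is strict somewhere — with `δ = m - 1` there is `λ ⊢ mδ` (`≤ m²` parts) such that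
`finrank T_Λ(δ, λ*) < finrank T_Λ(0, λ*)`.

Proof (line `adjugate-pfaffian-kernel`, crux idea card of ideator 1, triage r1 ×3, lead's def-free reshape; the seven
registered stubs are the seven imported `Theorems/ValuativeGCTCutBites*.lean` files, same namespace):
the witness `W_m = det (Σ_{k<m} cof X_(k,k))` (`cof Y = adjugate Yᵀ`, `X_(k,k)` = row `(k,k)` of `A ∈ End(ℂ^{m×m})`
as an `m × m` matrix) is a form of degree `m(m-1)` (`stub_adjDet_isHomogeneous`), invariant under the crux's right
action of EVERY `M` in the abstract `End`-stabiliser `{M | linSubst M det_m = det_m}` WITHOUT Frobenius' normal form —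
contragredient lemma: `linSubst M det_m = det_m ⇒` cofactor chain rule `M·cof(T_M Y) = cof Y` (`stub_cofactor_chainRule`,
Jacobi) `⇒ IsUnit M` (`stub_detStab_isUnit`, cofactors span) and `linSubst Mᵀ det_m = det_m` (`stub_detStab_transpose`,
`cof ∘ cof = det^{m-2}·id`) `⇒ W_m(A·M) = W_m(A)` (`stub_adjDet_invariant`) —, and equal to `det J ^ m ≠ 0` at a sparse
point all of whose rows are skew (`stub_adjDet_sparsePoint`: corank-one skew `S_k` with `cof S_k = det J • E_kk`);
highest-weight extraction (`stub_hwExtraction`: complete reducibility + Lie–Kolchin + dominance + torus weights, all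
discharged tree facts) turns `W_m` into a `B`-semi-invariant `G ∈ T_Λ(0, λ*)` non-zero on `L_Λ`, and the cut criterion
(`finrank_lt_of_eval_ne_zero`, = `Cruxes/CutBites/Disproof.lean` §B) gives the strict inequality at every threshold
`t ≥ 1`, in particular `t = δ = m - 1 ≥ 2` (`3 ≤ m`; `δ` even, as Negative/NoCutInOddDegree demands).

Dictionary with the planner's skeleton (`Cruxes/CutBites/Lines/adjugate-pfaffian-kernel.lean`): `genMat m` ↦
`Matrix.of fun a b : Fin m => X (toLex (a, b))`; `tmat M Y` ↦ `Matrix.of fun a b => ∑ l, M l (toLex (a, b)) • Y …`;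
`cof Y` ↦ `Y.adjugateᵀ`; `rowMat m j` ↦ `Matrix.of fun a b : Fin m => X (j, toLex (a, b))`; `adjDet m` ↦
`Matrix.det (∑ k : Fin m, (Matrix.of fun a b : Fin m => X (toLex (k, k), toLex (a, b))).adjugateᵀ)`; `stabAct M` ↦
`MvPolynomial.aeval fun p => ∑ l, M l p.2 • X (p.1, l)`; `stabInv`/`hwSp`/`locus`/`skewU`/`truncU` ↦ the crux's
literal expressions.  Everything is def-free. [folklore]
-/

namespace Summit.ValiantsHypothesis.ValiantsHypothesis.Theorems.CutBitesAdjugate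

open Literature.NumberTheory.DiophantineGeometry Literature.Computability.AlgebraicComplexity
open MvPolynomial
open scoped BigOperators Matrix

-- `Summit.ValiantsHypothesis.ValiantsHypothesis.…` is the tree's mandated single-conjunct layout (Sub = Summit).
set_option linter.dupNamespace false

/-! ## §1 The seven registered stubs — ALL LANDED (imported above; namespace `…Theorems.CutBitesAdjugate`, same names):
`stub_detStab_isUnit` (p72008), `stub_cofactor_chainRule` (p72314), `stub_detStab_transpose` (p72413),
`stub_adjDet_invariant` (p72285), `stub_adjDet_isHomogeneous` (p71882), `stub_adjDet_sparsePoint` (p71981),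
`stub_hwExtraction` (p72311). -/

/-! ## §2 The cut criterion (= `Cruxes/CutBites/Disproof.lean` §B, def-free) -/

section Criterion

variable {σ : Type*}

/-- `Hom ⊓ P^t ⊓ S₁ ⊓ S₂ ≤ Hom ⊓ P^0 ⊓ S₁ ⊓ S₂` (powers of an ideal decrease). [folklore] -/
theorem inf_pow_le_inf_pow_zero (Hom S₁ S₂ : Submodule ℂ (MvPolynomial σ ℂ)) (P : Ideal (MvPolynomial σ ℂ)) (t : ℕ) :
    Hom ⊓ (P ^ t).restrictScalars ℂ ⊓ S₁ ⊓ S₂ ≤ Hom ⊓ (P ^ 0).restrictScalars ℂ ⊓ S₁ ⊓ S₂ :=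
  inf_le_inf_right _ (inf_le_inf_right _ (inf_le_inf_left _
    (Submodule.restrictScalars_mono ℂ (Ideal.pow_le_pow_right (Nat.zero_le t)))))

/-- For `t ≥ 1`, elements of `Hom ⊓ I(L)^t ⊓ S₁ ⊓ S₂` vanish on `L`. [folklore] -/
theorem eval_eq_zero_of_mem_inf_pow {Hom S₁ S₂ : Submodule ℂ (MvPolynomial σ ℂ)} {L : Set (σ → ℂ)} {t : ℕ}
    (ht : 0 < t) {G : MvPolynomial σ ℂ}
    (hG : G ∈ Hom ⊓ ((MvPolynomial.vanishingIdeal ℂ L) ^ t).restrictScalars ℂ ⊓ S₁ ⊓ S₂)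
    {p : σ → ℂ} (hp : p ∈ L) : MvPolynomial.eval p G = 0 := by
  have h1 : G ∈ ((MvPolynomial.vanishingIdeal ℂ L) ^ t).restrictScalars ℂ :=
    (Submodule.mem_inf.mp (Submodule.mem_inf.mp (Submodule.mem_inf.mp hG).1).1).2
  have h2 : G ∈ (MvPolynomial.vanishingIdeal ℂ L).restrictScalars ℂ :=
    Submodule.restrictScalars_mono ℂ ((Ideal.pow_le_pow_right ht).trans_eq (pow_one _)) h1
  rw [Submodule.restrictScalars_mem, mem_vanishingIdeal_iff] at h2
  simpa [MvPolynomial.coe_aeval_eq_eval] using h2 p hp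

/-- **Cut criterion** (Disproof §B): one element of the `t = 0` space with one non-zero value on `L` forces
`finrank (t-space) < finrank (0-space)` for every `t ≥ 1`, provided the `0`-space sits in a finite-dimensional `Hom`.
[folklore] -/
theorem finrank_lt_of_eval_ne_zero {Hom S₁ S₂ : Submodule ℂ (MvPolynomial σ ℂ)} [Module.Finite ℂ ↥Hom]
    {L : Set (σ → ℂ)} {t : ℕ} (ht : 0 < t) {G : MvPolynomial σ ℂ}
    (hG : G ∈ Hom ⊓ ((MvPolynomial.vanishingIdeal ℂ L) ^ 0).restrictScalars ℂ ⊓ S₁ ⊓ S₂)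
    {p : σ → ℂ} (hp : p ∈ L) (hGp : MvPolynomial.eval p G ≠ 0) :
    Module.finrank ℂ ↥(Hom ⊓ ((MvPolynomial.vanishingIdeal ℂ L) ^ t).restrictScalars ℂ ⊓ S₁ ⊓ S₂)
      < Module.finrank ℂ ↥(Hom ⊓ ((MvPolynomial.vanishingIdeal ℂ L) ^ 0).restrictScalars ℂ ⊓ S₁ ⊓ S₂) := by
  have hle : Hom ⊓ ((MvPolynomial.vanishingIdeal ℂ L) ^ 0).restrictScalars ℂ ⊓ S₁ ⊓ S₂ ≤ Hom :=
    inf_le_left.trans (inf_le_left.trans inf_le_left)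
  haveI : FiniteDimensional ℂ ↥(Hom ⊓ ((MvPolynomial.vanishingIdeal ℂ L) ^ 0).restrictScalars ℂ ⊓ S₁ ⊓ S₂) :=
    Submodule.finiteDimensional_of_le hle
  refine Submodule.finrank_lt_finrank_of_lt
    (lt_of_le_of_ne (inf_pow_le_inf_pow_zero Hom S₁ S₂ _ t) fun h => hGp ?_)
  have hG' : G ∈ Hom ⊓ ((MvPolynomial.vanishingIdeal ℂ L) ^ t).restrictScalars ℂ ⊓ S₁ ⊓ S₂ := by
    rw [h]; exact hG
  exact eval_eq_zero_of_mem_inf_pow ht hG' hp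

end Criterion

/-! ## §3 Membership bookkeeping and the crux -/

/-- Unfolding membership in the crux's stabiliser factor `⨅_M ker (φ_M - id)`. [folklore] -/
theorem mem_iInf_ker_sub_id_iff {m : ℕ} {G : MvPolynomial (MatIdx m × MatIdx m) ℂ} :
    G ∈ (⨅ (M : Matrix (MatIdx m) (MatIdx m) ℂ)
        (_ : linSubst (MatIdx m) ℂ M (detFormLex ℂ m) = detFormLex ℂ m),
        LinearMap.ker ((MvPolynomial.aeval (R := ℂ) fun p : MatIdx m × MatIdx m =>
          ∑ l : MatIdx m, M l p.2 • MvPolynomial.X (p.1, l)).toLinearMap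
          - LinearMap.id (R := ℂ) (M := MvPolynomial (MatIdx m × MatIdx m) ℂ))) ↔
      ∀ M : Matrix (MatIdx m) (MatIdx m) ℂ, linSubst (MatIdx m) ℂ M (detFormLex ℂ m) = detFormLex ℂ m →
        MvPolynomial.aeval (R := ℂ) (fun p : MatIdx m × MatIdx m =>
          ∑ l : MatIdx m, M l p.2 • (X (p.1, l) : MvPolynomial (MatIdx m × MatIdx m) ℂ)) G = G := by
  simp only [Submodule.mem_iInf, LinearMap.mem_ker, LinearMap.sub_apply, sub_eq_zero,
    AlgHom.toLinearMap_apply, LinearMap.id_coe, id_eq]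

/-- Unfolding membership in the crux's Borel factor `⨅_g ker (ψ_g - χ(g) • id)`. [folklore] -/
theorem mem_iInf_ker_sub_smul_iff {m : ℕ} {χ : Weight (MatIdx m)} {G : MvPolynomial (MatIdx m × MatIdx m) ℂ} :
    G ∈ (⨅ (g : Matrix.GeneralLinearGroup (MatIdx m) ℂ) (_ : IsUpperTriangular g),
        LinearMap.ker ((MvPolynomial.aeval (R := ℂ) fun p : MatIdx m × MatIdx m =>
          ∑ l : MatIdx m, ((g⁻¹ : Matrix.GeneralLinearGroup (MatIdx m) ℂ) :
            Matrix (MatIdx m) (MatIdx m) ℂ) p.1 l • MvPolynomial.X (l, p.2)).toLinearMap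
          - weightChar χ g • LinearMap.id (R := ℂ) (M := MvPolynomial (MatIdx m × MatIdx m) ℂ))) ↔
      ∀ g : Matrix.GeneralLinearGroup (MatIdx m) ℂ, IsUpperTriangular g →
        MvPolynomial.aeval (R := ℂ) (fun p : MatIdx m × MatIdx m =>
          ∑ l : MatIdx m, ((g⁻¹ : Matrix.GeneralLinearGroup (MatIdx m) ℂ) : Matrix (MatIdx m) (MatIdx m) ℂ) p.1 l •
            (X (l, p.2) : MvPolynomial (MatIdx m × MatIdx m) ℂ)) G = weightChar χ g • G := by
  simp only [Submodule.mem_iInf, LinearMap.mem_ker, LinearMap.sub_apply, sub_eq_zero,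
    AlgHom.toLinearMap_apply, LinearMap.smul_apply, LinearMap.id_coe, id_eq]

/-- **The crux from the seven stubs** (hypotheses = the stub statements verbatim; see `CutBites_proof`).  For odd
`m ≥ 3`: `δ = m - 1`, witness `W_m`; Stubs 2 → 1 → 3 → 4 give its invariance under every stabilising `M`, Stub 5 its
degree, Stub 6 a skew point where it is non-zero, Stub 7 the partition `λ` and the semi-invariant `G' ∈ T 0` non-zero
on `L_Λ`, and the cut criterion `finrank (T δ) < finrank (T 0)` — the crux's conclusion by `let`-unfolding. [folklore] -/
theorem CutBites_of
    (h₁ : ∀ (m : ℕ) (M : Matrix (MatIdx m) (MatIdx m) ℂ),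
      (Matrix.of fun a b : Fin m => ∑ l : MatIdx m, M (toLex (a, b)) l •
        (Matrix.of fun a' b' : Fin m => ∑ l' : MatIdx m, M l' (toLex (a', b')) •
          (X l' : MvPolynomial (MatIdx m) ℂ)).adjugateᵀ (ofLex l).1 (ofLex l).2)
      = (Matrix.of fun a b : Fin m => (X (toLex (a, b)) : MvPolynomial (MatIdx m) ℂ)).adjugateᵀ → IsUnit M)
    (h₂ : ∀ (m : ℕ) (M : Matrix (MatIdx m) (MatIdx m) ℂ),
      linSubst (MatIdx m) ℂ M (detFormLex ℂ m) = detFormLex ℂ m →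
      (Matrix.of fun a b : Fin m => ∑ l : MatIdx m, M (toLex (a, b)) l •
        (Matrix.of fun a' b' : Fin m => ∑ l' : MatIdx m, M l' (toLex (a', b')) •
          (X l' : MvPolynomial (MatIdx m) ℂ)).adjugateᵀ (ofLex l).1 (ofLex l).2)
      = (Matrix.of fun a b : Fin m => (X (toLex (a, b)) : MvPolynomial (MatIdx m) ℂ)).adjugateᵀ)
    (h₃ : ∀ (m : ℕ) (M : Matrix (MatIdx m) (MatIdx m) ℂ),
      linSubst (MatIdx m) ℂ M (detFormLex ℂ m) = detFormLex ℂ m → IsUnit M →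
      (Matrix.of fun a b : Fin m => ∑ l : MatIdx m, M (toLex (a, b)) l •
        (Matrix.of fun a' b' : Fin m => ∑ l' : MatIdx m, M l' (toLex (a', b')) •
          (X l' : MvPolynomial (MatIdx m) ℂ)).adjugateᵀ (ofLex l).1 (ofLex l).2)
      = (Matrix.of fun a b : Fin m => (X (toLex (a, b)) : MvPolynomial (MatIdx m) ℂ)).adjugateᵀ →
      linSubst (MatIdx m) ℂ Mᵀ (detFormLex ℂ m) = detFormLex ℂ m)
    (h₄ : ∀ (m : ℕ) (M : Matrix (MatIdx m) (MatIdx m) ℂ),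
      (Matrix.of fun a b : Fin m => ∑ l : MatIdx m, M (toLex (a, b)) l •
        (Matrix.of fun a' b' : Fin m => ∑ l' : MatIdx m, M l' (toLex (a', b')) •
          (X l' : MvPolynomial (MatIdx m) ℂ)).adjugateᵀ (ofLex l).1 (ofLex l).2)
      = (Matrix.of fun a b : Fin m => (X (toLex (a, b)) : MvPolynomial (MatIdx m) ℂ)).adjugateᵀ →
      linSubst (MatIdx m) ℂ Mᵀ (detFormLex ℂ m) = detFormLex ℂ m →
      MvPolynomial.aeval (R := ℂ)
        (fun p : MatIdx m × MatIdx m => ∑ l : MatIdx m, M l p.2 • (X (p.1, l) : MvPolynomial (MatIdx m × MatIdx m) ℂ))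
        (Matrix.det (∑ k : Fin m, (Matrix.of fun a b : Fin m =>
          (X (toLex (k, k), toLex (a, b)) : MvPolynomial (MatIdx m × MatIdx m) ℂ)).adjugateᵀ))
      = Matrix.det (∑ k : Fin m, (Matrix.of fun a b : Fin m =>
          (X (toLex (k, k), toLex (a, b)) : MvPolynomial (MatIdx m × MatIdx m) ℂ)).adjugateᵀ))
    (h₅ : ∀ m : ℕ, (Matrix.det (∑ k : Fin m, (Matrix.of fun a b : Fin m =>
        (X (toLex (k, k), toLex (a, b)) : MvPolynomial (MatIdx m × MatIdx m) ℂ)).adjugateᵀ)).IsHomogeneous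
      (m * (m - 1)))
    (h₆ : ∀ m : ℕ, Odd m → 3 ≤ m → ∃ p : MatIdx m × MatIdx m → ℂ,
      (∀ j : MatIdx m, (fun i => p (j, i)) ∈
        Submodule.span ℂ {u : MatIdx m → ℂ | ∀ a b : Fin m, u (toLex (a, b)) = -u (toLex (b, a))}) ∧
      MvPolynomial.eval p (Matrix.det (∑ k : Fin m, (Matrix.of fun a b : Fin m =>
        (X (toLex (k, k), toLex (a, b)) : MvPolynomial (MatIdx m × MatIdx m) ℂ)).adjugateᵀ)) ≠ 0)
    (h₇ : ∀ (m D : ℕ) (U : Submodule ℂ (MatIdx m → ℂ)) (G : MvPolynomial (MatIdx m × MatIdx m) ℂ),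
      G.IsHomogeneous D →
      (∀ M : Matrix (MatIdx m) (MatIdx m) ℂ, linSubst (MatIdx m) ℂ M (detFormLex ℂ m) = detFormLex ℂ m →
        MvPolynomial.aeval (R := ℂ) (fun p : MatIdx m × MatIdx m =>
          ∑ l : MatIdx m, M l p.2 • (X (p.1, l) : MvPolynomial (MatIdx m × MatIdx m) ℂ)) G = G) →
      ∀ p : MatIdx m × MatIdx m → ℂ, (∀ j : MatIdx m, (fun i => p (j, i)) ∈ U) →
      MvPolynomial.eval p G ≠ 0 →
      ∃ lam : Nat.Partition D, lam.parts.card ≤ m * m ∧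
        ∃ G' : MvPolynomial (MatIdx m × MatIdx m) ℂ, G'.IsHomogeneous D ∧
          (∀ M : Matrix (MatIdx m) (MatIdx m) ℂ, linSubst (MatIdx m) ℂ M (detFormLex ℂ m) = detFormLex ℂ m →
            MvPolynomial.aeval (R := ℂ) (fun p : MatIdx m × MatIdx m =>
              ∑ l : MatIdx m, M l p.2 • (X (p.1, l) : MvPolynomial (MatIdx m × MatIdx m) ℂ)) G' = G') ∧
          (∀ g : Matrix.GeneralLinearGroup (MatIdx m) ℂ, IsUpperTriangular g →
            MvPolynomial.aeval (R := ℂ) (fun p : MatIdx m × MatIdx m =>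
              ∑ l : MatIdx m, ((g⁻¹ : Matrix.GeneralLinearGroup (MatIdx m) ℂ) : Matrix (MatIdx m) (MatIdx m) ℂ) p.1 l •
                (X (l, p.2) : MvPolynomial (MatIdx m × MatIdx m) ℂ)) G'
              = weightChar (Weight.dualOfPartition (m * m) lam).toMatIdx g • G') ∧
          ∃ p' : MatIdx m × MatIdx m → ℂ, (∀ j : MatIdx m, (fun i => p' (j, i)) ∈ U) ∧
            MvPolynomial.eval p' G' ≠ 0) :
    Theses.ValuativeGCT.CutBites := by
  intro m hm h3
  -- the witness and its three properties
  set W : MvPolynomial (MatIdx m × MatIdx m) ℂ := Matrix.det (∑ k : Fin m, (Matrix.of fun a b : Fin m =>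
    (X (toLex (k, k), toLex (a, b)) : MvPolynomial (MatIdx m × MatIdx m) ℂ)).adjugateᵀ) with hWdef
  have hWs : ∀ M : Matrix (MatIdx m) (MatIdx m) ℂ, linSubst (MatIdx m) ℂ M (detFormLex ℂ m) = detFormLex ℂ m →
      MvPolynomial.aeval (R := ℂ) (fun p : MatIdx m × MatIdx m =>
        ∑ l : MatIdx m, M l p.2 • (X (p.1, l) : MvPolynomial (MatIdx m × MatIdx m) ℂ)) W = W := by
    intro M hM
    have hC := h₂ m M hM
    have hU := h₁ m M hC
    exact h₄ m M hC (h₃ m M hM hU hC)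
  have hWh : W.IsHomogeneous (m * (m - 1)) := h₅ m
  obtain ⟨p, hp, hWp⟩ := h₆ m hm h3
  -- highest-weight extraction
  obtain ⟨lam, hcard, G, hGh, hGs, hGw, p', hp', hGp'⟩ := h₇ m (m * (m - 1)) _ W hWh hWs p hp hWp
  have hδ : 0 < m - 1 := by omega
  refine ⟨m - 1, lam, hcard, ?_⟩
  -- membership of `G` in `T 0` and the cut criterion
  have : Module.Finite ℂ ↥(MvPolynomial.homogeneousSubmodule (MatIdx m × MatIdx m) ℂ (m * (m - 1))) :=
    Module.Finite.iff_fg.mpr (MvPolynomial.homogeneousSubmodule_fg _ ℂ _)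
  refine finrank_lt_of_eval_ne_zero hδ ?_ hp' hGp'
  refine Submodule.mem_inf.mpr ⟨Submodule.mem_inf.mpr ⟨Submodule.mem_inf.mpr ⟨?_, ?_⟩, ?_⟩, ?_⟩
  · exact (mem_homogeneousSubmodule _ _).mpr hGh
  · rw [pow_zero, Ideal.one_eq_top, Submodule.restrictScalars_top]
    exact Submodule.mem_top
  · exact mem_iInf_ker_sub_id_iff.mpr hGs
  · exact mem_iInf_ker_sub_smul_iff.mpr hGw

/-- **THE CUT BITES** — closing theorem of crux `stmt-ValiantsHypothesis-12626` (`Theses.ValuativeGCT.CutBites`):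
`CutBites_of` applied to the seven registered stubs of the line `adjugate-pfaffian-kernel`. [folklore] -/
theorem CutBites_proof : Theses.ValuativeGCT.CutBites :=
  CutBites_of stub_detStab_isUnit stub_cofactor_chainRule stub_detStab_transpose stub_adjDet_invariant
    stub_adjDet_isHomogeneous stub_adjDet_sparsePoint stub_hwExtraction

end Summit.ValiantsHypothesis.ValiantsHypothesis.Theorems.CutBitesAdjugate
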